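import Summits.HodgeConjecture.HodgeConjecture.Theorems.Ring2AbelianAllAndreCrossCorrespondence
import HarnessLib

/-!
# Ring 2 · sub-cell AbelianAll (ALL ABELIAN VARIETIES), André axis, part XIV-e — THE GENERAL RUNG: the degree-`p`
# clause of the fibre-class Lefschetz operator (β′_f) from ALGEBRAIC INVARIANT CLASSES in degrees `2p` and
# `2(d-p)` on ONE fibre, with the explicit cycle `∑ᵢ Dᵢ × Aᵢ`; hence (β′_f) ⟸ "degreewise algebraic fixed part"

HONEST FRAMING (page 1, verbatim): **research route, not a corollary; conditional on HC_CM plus one named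
minimal statement.** Cell line: research route conditional on HC_CM; not a corollary; Q11.4-sentence-2
already refuted in dim ≥ 3. Nothing in this file proves a case of the Hodge conjecture for an abelian variety.
`HC_CM` = `Theses.RankFourFaces.CMAbelianHodge` (a BINDER), item `Theses.RankFourFaces.CMToAbelian` (stmt-16267)
OPEN and not closed here. Seat `pub-hodge-ring2-ab-andre-2`, gen 6 (RING2-MAP §AbelianAll AA2.41).

## What is proved (theorems only; no definition, no named fact, no sorry, no Hodge-conjecture input)

* §1 `exists_reproducing_pairs_of_perfect` — linear algebra: for `j₁ : V₁ → U₁`, `j₂ : V₂ → U₂`, subspaces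
  `Nᵢ` with `jᵢ(Nᵢ) = jᵢ(Vᵢ)`, and a bilinear `B : V₂ × V₁ → K` killing the kernels and non-degenerate modulo them
  on both sides, there are `Aᵢ ∈ N₂`, `Dᵢ ∈ N₁` with `j₁(∑ᵢ B(Aᵢ, w) • Dᵢ) = j₁ w` (the induced pairing of the
  quotients is perfect: dimension count with `Subspace.dual_finrank_eq`; dual basis through
  `LinearEquiv.ofBijective`).
* §2 **`fibreClassLefschetz_deg_of_algebraicInvariants`** — for a compact pencil `f : 𝒳 ⟶ S` of abelian `d`-folds,
  `p + q = d`, and a point `t₀` at which `j_{t₀}^* H²ᵖ(𝒳) = j_{t₀}^*(Nᵖ H²ᵖ(𝒳))` and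
  `j_{t₀}^* H^{2q}(𝒳) = j_{t₀}^*(N^q H^{2q}(𝒳))`: the degree-`p` clause of `FibreClassLefschetzOn hf` holds, the
  correspondence being the action (part XIV-a) of `∑ᵢ pr₁^* Dᵢ ∪ pr₂^* Aᵢ`, `Dᵢ ∈ Nᵖ`, `Aᵢ ∈ N^q` dual bases for
  `B(A, W) = τ((W ∪ [𝒳_{t₀}]) ∪ A)` — perfect modulo `ker j_{t₀}^*` by Poincaré duality on `𝒳(ℂ)` and the kernel
  identity (κ) in degrees `p` and `q` (part XII-e); change of fibre by (φ) (part XIII-e) and flatness.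
  **`fibreClassLefschetzOn_of_algebraicInvariants`**: (β′_f) ⟸ the hypothesis in every degree `p ≤ d`.

READING (RING2-MAP AA2.41). Degree by degree, the Lefschetz-type `B_min` of the André axis for a pencil is
implied by "the invariant classes `j_{t₀}^* H²ᵖ(𝒳) ⊆ H²ᵖ(𝒳_{t₀})` are restrictions of ALGEBRAIC classes" in
the two complementary degrees, with the inverting cycle WRITTEN DOWN (a sum of products `Dᵢ × Aᵢ` of
algebraic cycles of `𝒳`). The input is automatic for `p ∈ {0, d}` (parts XIV-c: `1`, `Kᵈ`), reduces to divisors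
for `p ∈ {1, d-1}` (parts XIV-b/d: hard Lefschetz), and is the open question itself where invariant classes are
not known to be algebraic — e.g. the W₆ habitat in degree `6` (the Weil classes are `SU(3,3)`-invariant).

References: Abdulali1994FamiliesAV (Conj. 5.3, Thm. 5.5 p. 1130); Andre1996Motifs (§5.1, §6.3 Remarque 2 p. 33);
VoisinHodgeII2003 ((10.7), Prop. 9.20); HatcherAT2002 (§3.3 Prop. 3.38); DeligneHodgeII1971 (4.1.1);
Fulton1998 (§19.1 Prop. 19.1.1).
-/

noncomputable section

set_option linter.dupNamespace false

namespace Summit.HodgeConjecture.HodgeConjecture.Ring2.AbelianAll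

open CategoryTheory AlgebraicGeometry MonoidalCategory CartesianMonoidalCategory
open Literature.AlgebraicGeometry Literature.AlgebraicGeometry.Motives
open Literature.AlgebraicGeometry.HodgeTheory
open Literature.AlgebraicTopology.SingularHomology (singularCohomology cupProduct cupProduct_one'
  cupProduct_assoc cupProduct_gradedComm_holds singularCohomologyZeroEquiv cupPairing
  isPerfPair_cupPairing_of_field_holds)

variable {𝒳 S : SchemeOver ℂ}

/-! ## §1 Linear algebra: dual bases for a pairing between two spaces, perfect modulo two kernels -/

/-- **Dual bases modulo kernels, two-space form.** Let `j₁ : V₁ → U₁`, `j₂ : V₂ → U₂` be linear (`V₁`, `V₂`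
finite-dimensional), `N₁ ≤ V₁`, `N₂ ≤ V₂` subspaces with `jᵢ(Nᵢ) = jᵢ(Vᵢ)`, and `B : V₂ × V₁ → K` bilinear, killing
`ker j₂` on the left and `ker j₁` on the right, and non-degenerate modulo these kernels on BOTH sides. Then there
are `Aᵢ ∈ N₂`, `Dᵢ ∈ N₁` with `j₁(∑ᵢ B(Aᵢ, w) • Dᵢ) = j₁(w)` for every `w` (the induced pairing
`V₂/ker j₂ × V₁/ker j₁ → K` is perfect; take a basis of `V₁/ker j₁` lifted to `N₁` and its dual basis lifted to
`N₂`). [folklore] -/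
theorem exists_reproducing_pairs_of_perfect {K V₁ V₂ U₁ U₂ : Type*} [Field K]
    [AddCommGroup V₁] [Module K V₁] [FiniteDimensional K V₁] [AddCommGroup V₂] [Module K V₂]
    [FiniteDimensional K V₂] [AddCommGroup U₁] [Module K U₁] [AddCommGroup U₂] [Module K U₂]
    (j₁ : V₁ →ₗ[K] U₁) (j₂ : V₂ →ₗ[K] U₂) (N₁ : Submodule K V₁) (N₂ : Submodule K V₂)
    (hN₁ : ∀ v, ∃ n ∈ N₁, j₁ n = j₁ v) (hN₂ : ∀ v, ∃ n ∈ N₂, j₂ n = j₂ v)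
    (B : V₂ →ₗ[K] V₁ →ₗ[K] K)
    (hB₁ : ∀ a, j₂ a = 0 → ∀ w, B a w = 0) (hB₂ : ∀ w, j₁ w = 0 → ∀ a, B a w = 0)
    (hB₃ : ∀ a, (∀ w, B a w = 0) → j₂ a = 0) (hB₄ : ∀ w, (∀ a, B a w = 0) → j₁ w = 0) :
    ∃ (r : ℕ) (A : Fin r → V₂) (D : Fin r → V₁), (∀ i, A i ∈ N₂) ∧ (∀ i, D i ∈ N₁) ∧
      ∀ w, j₁ (∑ i, B (A i) w • D i) = j₁ w := by
  classical
  set P₁ : Submodule K V₁ := LinearMap.ker j₁ with hP₁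
  set P₂ : Submodule K V₂ := LinearMap.ker j₂ with hP₂
  -- descend `B` in the first argument
  have hk₁ : P₂ ≤ LinearMap.ker B := fun a ha ↦ by
    rw [LinearMap.mem_ker]
    ext w
    exact hB₁ a (LinearMap.mem_ker.1 ha) w
  set B₁ : (V₂ ⧸ P₂) →ₗ[K] V₁ →ₗ[K] K := P₂.liftQ B hk₁ with hB₁def
  have hB₁_mk : ∀ a w, B₁ (Submodule.Quotient.mk a) w = B a w := fun a w ↦ rfl
  -- descend in the second argument
  have hk₂ : P₁ ≤ LinearMap.ker B₁.flip := fun w hw ↦ by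
    rw [LinearMap.mem_ker]
    refine LinearMap.ext fun q ↦ ?_
    obtain ⟨a, rfl⟩ := Submodule.mkQ_surjective P₂ q
    change B₁ (Submodule.Quotient.mk a) w = 0
    rw [hB₁_mk]
    exact hB₂ w (LinearMap.mem_ker.1 hw) a
  set Bq : (V₂ ⧸ P₂) →ₗ[K] (V₁ ⧸ P₁) →ₗ[K] K := (P₁.liftQ B₁.flip hk₂).flip with hBqdef
  have hBq_mk : ∀ a w, Bq (Submodule.Quotient.mk a) (Submodule.Quotient.mk w) = B a w := fun a w ↦ rfl
  -- injective on both sides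
  have hinj : Function.Injective Bq := by
    rw [← LinearMap.ker_eq_bot, Submodule.eq_bot_iff]
    intro q hq
    obtain ⟨a, rfl⟩ := Submodule.mkQ_surjective P₂ q
    change Submodule.Quotient.mk a = (0 : V₂ ⧸ P₂)
    rw [Submodule.Quotient.mk_eq_zero]
    refine LinearMap.mem_ker.2 (hB₃ a fun w ↦ ?_)
    rw [← hBq_mk]
    have := LinearMap.congr_fun (LinearMap.mem_ker.1 hq) (Submodule.Quotient.mk w)
    exact this
  have hinj' : Function.Injective Bq.flip := by
    rw [← LinearMap.ker_eq_bot, Submodule.eq_bot_iff]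
    intro q hq
    obtain ⟨w, rfl⟩ := Submodule.mkQ_surjective P₁ q
    change Submodule.Quotient.mk w = (0 : V₁ ⧸ P₁)
    rw [Submodule.Quotient.mk_eq_zero]
    refine LinearMap.mem_ker.2 (hB₄ w fun a ↦ ?_)
    rw [← hBq_mk]
    have := LinearMap.congr_fun (LinearMap.mem_ker.1 hq) (Submodule.Quotient.mk a)
    exact this
  -- dimensions agree, so `Bq : Q₂ → Dual Q₁` is bijective
  have hle₂ : Module.finrank K (V₂ ⧸ P₂) ≤ Module.finrank K (V₁ ⧸ P₁) := by
    have h := LinearMap.finrank_le_finrank_of_injective hinj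
    rwa [Subspace.dual_finrank_eq] at h
  have hle₁ : Module.finrank K (V₁ ⧸ P₁) ≤ Module.finrank K (V₂ ⧸ P₂) := by
    have h := LinearMap.finrank_le_finrank_of_injective hinj'
    rwa [Subspace.dual_finrank_eq] at h
  have hbij : Function.Bijective Bq := by
    refine ⟨hinj, ?_⟩
    have hdim : Module.finrank K (V₂ ⧸ P₂) = Module.finrank K (Module.Dual K (V₁ ⧸ P₁)) := by
      rw [Subspace.dual_finrank_eq]; exact le_antisymm hle₂ hle₁
    exact (LinearMap.injective_iff_surjective_of_finrank_eq_finrank hdim).1 hinj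
  set eB := LinearEquiv.ofBijective Bq hbij with heB
  have heB_apply : ∀ q, eB q = Bq q := fun _ ↦ rfl
  -- lifts to `N₁`, `N₂`
  have hlift₁ : ∀ q : V₁ ⧸ P₁, ∃ n ∈ N₁, Submodule.Quotient.mk n = q := fun q ↦ by
    obtain ⟨v, rfl⟩ := Submodule.mkQ_surjective P₁ q
    obtain ⟨n, hn, hjn⟩ := hN₁ v
    refine ⟨n, hn, ?_⟩
    change Submodule.Quotient.mk n = Submodule.Quotient.mk v
    rw [Submodule.Quotient.eq, hP₁, LinearMap.mem_ker, map_sub, hjn, sub_self]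
  have hlift₂ : ∀ q : V₂ ⧸ P₂, ∃ n ∈ N₂, Submodule.Quotient.mk n = q := fun q ↦ by
    obtain ⟨v, rfl⟩ := Submodule.mkQ_surjective P₂ q
    obtain ⟨n, hn, hjn⟩ := hN₂ v
    refine ⟨n, hn, ?_⟩
    change Submodule.Quotient.mk n = Submodule.Quotient.mk v
    rw [Submodule.Quotient.eq, hP₂, LinearMap.mem_ker, map_sub, hjn, sub_self]
  -- bases: `b` of `Q₁`, and the `Bq`-dual basis `b'` of `Q₂`
  set b := Module.finBasis K (V₁ ⧸ P₁) with hb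
  set b' : Fin (Module.finrank K (V₁ ⧸ P₁)) → V₂ ⧸ P₂ := fun i ↦ eB.symm (b.dualBasis i) with hb'
  have hcoord : ∀ (q : V₁ ⧸ P₁) (i), Bq (b' i) q = b.repr q i := fun q i ↦ by
    rw [hb', ← heB_apply, LinearEquiv.apply_symm_apply, Module.Basis.dualBasis_apply]
  choose A hA hAq using fun i ↦ hlift₂ (b' i)
  choose D hD hDq using fun i ↦ hlift₁ (b i)
  refine ⟨_, A, D, hA, hD, fun w ↦ ?_⟩
  have hq : Submodule.Quotient.mk (p := P₁) (∑ i, B (A i) w • D i) = Submodule.Quotient.mk w := by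
    have h1 : Submodule.Quotient.mk (p := P₁) (∑ i, B (A i) w • D i) = ∑ i, B (A i) w • b i := by
      rw [← Submodule.mkQ_apply, map_sum]
      refine Finset.sum_congr rfl fun i _ ↦ ?_
      rw [map_smul, Submodule.mkQ_apply, hDq]
    rw [h1]
    conv_rhs => rw [← b.sum_repr (Submodule.Quotient.mk w)]
    refine Finset.sum_congr rfl fun i _ ↦ ?_
    rw [← hcoord, ← hAq, hBq_mk]
  have hmem : j₁ (∑ i, B (A i) w • D i - w) = 0 := LinearMap.mem_ker.1 ((Submodule.Quotient.eq P₁).1 hq)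
  rwa [map_sub, sub_eq_zero] at hmem

/-! ## §2 The degree-`p` clause of (β′_f) from ALGEBRAIC INVARIANT CLASSES in degrees `2p` and `2(d - p)` -/

/-- **THE GENERAL RUNG: (β′_f) in degree `p` from algebraic invariant classes in the complementary degrees
`2p` and `2q`, `p + q = d`.** Let `f : 𝒳 ⟶ S` be a compact pencil of abelian `d`-folds and `t₀` a point such
that every class of `j_{t₀}^* H²ᵖ(𝒳(ℂ); ℂ)` is the restriction of an ALGEBRAIC class of `𝒳` of codimension `p`, and
likewise in degree `2q` (`p + q = d`). THEN the degree-`p` clause of `FibreClassLefschetzOn hf` holds: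
`∃ T : H²ᵖ⁺²(𝒳) → H²ᵖ(𝒳)` INDUCED BY AN ALGEBRAIC CORRESPONDENCE with `j_s^* T(j_{t*} j_t^* W) = j_s^* W` — the
action of the codimension-`d` class `∑ᵢ pr₁^* Dᵢ ∪ pr₂^* Aᵢ` on `𝒳 × 𝒳`, `Dᵢ ∈ Nᵖ H²ᵖ(𝒳)`, `Aᵢ ∈ N^q H^{2q}(𝒳)`
dual bases (§1) for the pairing `B(A, W) = τ((W ∪ [𝒳_{t₀}]) ∪ A)`, which is PERFECT modulo `ker j_{t₀}^*` on
both sides by Poincaré duality on `𝒳(ℂ)` and the kernel identity (κ) in degrees `p` and `q` (part XII-e). The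
change of fibres is (φ) (part XIII-e) and flatness. Degree by degree, this converts the Lefschetz-type node
(β′_f) into "invariant classes are restrictions of algebraic classes" with the cycle written down; parts XIV-b/c/d
are the cases where that input is automatic (`p = 0, d`) or reducible to divisors (`p = 1, d - 1`, via hard
Lefschetz). No Hodge-conjecture input, no named fact. [cite: Abdulali1994FamiliesAV, Conjecture 5.3 and Theorem 5.5 (p. 1130)]
[cite: Andre1996Motifs, §6.3 Remarque 2 (p. 33)] [cite: VoisinHodgeII2003, proof of Thm. 10.17 (10.7)]
[cite: HatcherAT2002, §3.3 Prop. 3.38] [cite: DeligneHodgeII1971, Thm. 4.1.1] -/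
theorem fibreClassLefschetz_deg_of_algebraicInvariants {d : ℕ} {f : 𝒳 ⟶ S} (hf : IsCompactAbelianPencil f d)
    {p q : ℕ} (hpq : p + q = d) (t₀ : ComplexPoints S)
    (hNp : ∀ W : complexBetti 𝒳 (2 * p), ∃ D ∈ algebraicClasses 𝒳 p,
      complexBetti.map (fiberι f t₀) (2 * p) D = complexBetti.map (fiberι f t₀) (2 * p) W)
    (hNq : ∀ A : complexBetti 𝒳 (2 * q), ∃ C ∈ algebraicClasses 𝒳 q,
      complexBetti.map (fiberι f t₀) (2 * q) C = complexBetti.map (fiberι f t₀) (2 * q) A) :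
    ∃ T : complexBetti 𝒳 (2 * (p + 1)) →ₗ[ℂ] complexBetti 𝒳 (2 * p),
      IsAlgebraicCorrespondence (d + 1) (d + 1) 𝒳 𝒳 T ∧
        ∀ (W : complexBetti 𝒳 (2 * p)) (t s : ComplexPoints S),
          complexBetti.map (fiberι f s) (2 * p) (T (fiberGysin hf t p (complexBetti.map (fiberι f t) (2 * p) W))) =
            complexBetti.map (fiberι f s) (2 * p) W := by
  have h𝒳 := hf.isSmoothProjective_total
  haveI : Module.Finite ℂ (complexBetti 𝒳 (2 * p)) := finite_complexBetti h𝒳 _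
  haveI : Module.Finite ℂ (complexBetti 𝒳 (2 * q)) := finite_complexBetti h𝒳 _
  obtain ⟨τ, hτ0, hτT⟩ := exists_crossTrace h𝒳 h𝒳
  -- notation
  set j₁ : complexBetti 𝒳 (2 * p) →ₗ[ℂ] complexBetti (fiberOver f t₀) (2 * p) :=
    (complexBetti.map (fiberι f t₀) (2 * p)).hom with hj₁
  have hj₁apply : ∀ W, j₁ W = complexBetti.map (fiberι f t₀) (2 * p) W := fun _ ↦ rfl
  set j₂ : complexBetti 𝒳 (2 * q) →ₗ[ℂ] complexBetti (fiberOver f t₀) (2 * q) :=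
    (complexBetti.map (fiberι f t₀) (2 * q)).hom with hj₂
  have hj₂apply : ∀ A, j₂ A = complexBetti.map (fiberι f t₀) (2 * q) A := fun _ ↦ rfl
  set L : complexBetti 𝒳 (2 * p) →ₗ[ℂ] complexBetti 𝒳 (2 * (p + 1)) := fiberGysin hf t₀ p ∘ₗ j₁ with hL
  have hLapply : ∀ W, L W = fiberGysin hf t₀ p (complexBetti.map (fiberι f t₀) (2 * p) W) := fun _ ↦ rfl
  have hak : 2 * (p + 1) + 2 * q = 2 * (d + 1) := by omega
  set B : complexBetti 𝒳 (2 * q) →ₗ[ℂ] complexBetti 𝒳 (2 * p) →ₗ[ℂ] ℂ :=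
    (((cupProduct hak).compl₁₂ L LinearMap.id).compr₂ τ).flip with hB
  have hBapply : ∀ A W, B A W = τ (cupProduct hak (L W) A) := fun _ _ ↦ rfl
  set F := fiberGysin hf t₀ 0 (singularCohomology.one ℂ (ComplexPoints (fiberOver f t₀))) with hF
  have h1F : 2 * p + 2 * (0 + 1) = 2 * (p + 1) := by ring
  have hLW : ∀ W : complexBetti 𝒳 (2 * p), L W = cupProduct h1F W F := fun W ↦
    fiberGysin_map_fiberι_eq_cupProduct hf t₀ W
  letI := h𝒳.chartedSpace
  haveI := ComplexPoints.compactSpace_of_isSmoothProjective h𝒳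
  haveI := ComplexPoints.t2Space_of_isSmoothProjective h𝒳
  -- the four hypotheses of §1
  have hB₂ : ∀ W, j₁ W = 0 → ∀ A, B A W = 0 := fun W hW A ↦ by
    rw [hBapply, hLapply, ← hj₁apply, hW, map_zero, map_zero, LinearMap.zero_apply, map_zero]
  have hB₁ : ∀ A, j₂ A = 0 → ∀ W, B A W = 0 := fun A hA W ↦ by
    rw [hBapply]
    have hcomm := cupProduct_gradedComm_holds ℂ _ hak (show 2 * q + 2 * (p + 1) = 2 * (d + 1) by omega) (L W) A
    rw [hcomm, hLapply]
    have hproj := complexGysin_cup (μ := complexOrientationFamily) hasPoincareDuality_complexOrientationFamily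
      (hf.isSmoothProjective_fiberOver t₀) h𝒳 (fiberι f t₀)
      (show 2 * q + 2 * p = 2 * d by omega)
      (show 2 * d + 2 * (d + 1) = 2 * (d + 1) + 2 * d by ring)
      (show 2 * p + 2 * (d + 1) = 2 * (p + 1) + 2 * d by ring)
      (show 2 * q + 2 * (p + 1) = 2 * (d + 1) by omega) A
      (complexBetti.map (fiberι f t₀) (2 * p) W)
    have hfg : fiberGysin hf t₀ p (complexBetti.map (fiberι f t₀) (2 * p) W) =
        complexGysin complexOrientationFamily (hf.isSmoothProjective_fiberOver t₀) h𝒳 (fiberι f t₀)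
          (show 2 * p + 2 * (d + 1) = 2 * (p + 1) + 2 * d by ring)
          (complexBetti.map (fiberι f t₀) (2 * p) W) := rfl
    rw [hfg, ← hproj, ← hj₂apply A, hA, map_zero, LinearMap.zero_apply, map_zero, smul_zero, map_zero]
  have hB₃ : ∀ A, (∀ W, B A W = 0) → j₂ A = 0 := fun A hA ↦ by
    have h1 : ∀ W : complexBetti 𝒳 (2 * p), cupProduct hak (L W) A = 0 := fun W ↦
      hτ0 _ (by rw [← hBapply]; exact hA W)
    have hFA : 2 * (0 + 1) + 2 * q = 2 * (q + 1) := by ring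
    have hdeg : 2 * p + 2 * (q + 1) = 2 * (d + 1) := by omega
    set y := cupProduct hFA F A with hy
    have h2 : ∀ W : complexBetti 𝒳 (2 * p), cupProduct hdeg W y = 0 := fun W ↦ by
      rw [hy, ← cupProduct_assoc h1F hFA hak hdeg, ← hLW W]
      exact h1 W
    have hy0 : y = 0 := by
      have hPerf : (cupPairing (complexOrientationFamily h𝒳) hdeg).IsPerfPair :=
        isPerfPair_cupPairing_of_field_holds
      refine (LinearMap.IsPerfPair.bijective_right (cupPairing (complexOrientationFamily h𝒳) hdeg)).1 ?_
      rw [map_zero]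
      ext W
      rw [LinearMap.flip_apply, LinearMap.zero_apply,
        Literature.AlgebraicTopology.SingularHomology.cupPairing_apply, h2 W, map_zero, LinearMap.zero_apply]
    have h3 : fiberGysin hf t₀ q (complexBetti.map (fiberι f t₀) (2 * q) A) = 0 := by
      rw [fiberGysin_map_fiberι_eq_cupProduct hf t₀ A]
      have hcomm := cupProduct_gradedComm_holds ℂ _ hFA (show 2 * q + 2 * (0 + 1) = 2 * (q + 1) by ring) F A
      rw [← hy, hy0, eq_comm, smul_eq_zero] at hcomm
      rcases hcomm with h | h
      · exact absurd h (by simp)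
      · exact h
    rw [hj₂apply]
    exact fibreGysinKernelOn_holds hf q t₀ t₀ A h3
  have hB₄ : ∀ W, (∀ A, B A W = 0) → j₁ W = 0 := fun W hW ↦ by
    have h1 : ∀ A : complexBetti 𝒳 (2 * q), cupProduct hak (L W) A = 0 := fun A ↦
      hτ0 _ (by rw [← hBapply]; exact hW A)
    have hL0 : L W = 0 := by
      have hPerf : (cupPairing (complexOrientationFamily h𝒳) hak).IsPerfPair :=
        isPerfPair_cupPairing_of_field_holds
      refine (LinearMap.IsPerfPair.bijective_left (cupPairing (complexOrientationFamily h𝒳) hak)).1 ?_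
      rw [map_zero]
      ext A
      rw [LinearMap.zero_apply, Literature.AlgebraicTopology.SingularHomology.cupPairing_apply, h1 A, map_zero,
        LinearMap.zero_apply]
    rw [hj₁apply]
    exact fibreGysinKernelOn_holds hf p t₀ t₀ W (by rw [← hLapply]; exact hL0)
  -- §1: dual bases of algebraic classes
  obtain ⟨r, A, D, hA, hD, hrep⟩ := exists_reproducing_pairs_of_perfect j₁ j₂ (algebraicClasses 𝒳 p)
    (algebraicClasses 𝒳 q) (fun W ↦ hNp W) (fun A ↦ hNq A) B hB₁ hB₂ hB₃ hB₄
  obtain ⟨T, hT, hTc⟩ := hτT hak (show p ≤ d + 1 by omega) r D A hD hA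
  refine ⟨T, hT, fun W t s ↦ ?_⟩
  rw [fiberGysin_map_fiberι_eq_of_const hf (fibreClassConstantOn_holds hf) t t₀ W, ← hLapply, hTc]
  have hsum : (∑ i, τ (cupProduct hak (L W) (A i)) • D i) = ∑ i, B (A i) W • D i :=
    Finset.sum_congr rfl fun i _ ↦ by rw [hBapply]
  rw [hsum, ← sub_eq_zero, ← map_sub]
  refine map_fiberι_eq_zero_of_eq_zero hf (t := t₀) ?_ s
  rw [map_sub, sub_eq_zero]
  exact hrep W

/-- **(β′_f) from algebraic invariant classes in every degree.** If on one fibre `𝒳_{t₀}` of a compact pencil of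
abelian `d`-folds every class of `j_{t₀}^* H²ᵖ(𝒳)` is the restriction of an algebraic class of `𝒳`, for every
`p ≤ d`, then part VIII's fibre-class Lefschetz node `FibreClassLefschetzOn hf` holds — with explicit
codimension-`d` cycles `∑ᵢ Dᵢ × Aᵢ` on `𝒳 × 𝒳`. (The hypothesis is the degreewise "algebraic fixed part" of the
pencil at one fibre; it fails as soon as some invariant class is transcendental, e.g. the Weil classes of the W₆
habitat in degree `6`, where it IS the open question.) [cite: Abdulali1994FamiliesAV, Conjecture 5.3 and Theorem 5.5 (p. 1130)]
[cite: Andre1996Motifs, §6.3 Remarque 2 (p. 33)] -/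
theorem fibreClassLefschetzOn_of_algebraicInvariants {d : ℕ} {f : 𝒳 ⟶ S} (hf : IsCompactAbelianPencil f d)
    (t₀ : ComplexPoints S)
    (hN : ∀ p ≤ d, ∀ W : complexBetti 𝒳 (2 * p), ∃ D ∈ algebraicClasses 𝒳 p,
      complexBetti.map (fiberι f t₀) (2 * p) D = complexBetti.map (fiberι f t₀) (2 * p) W) :
    FibreClassLefschetzOn hf := fun p hp ↦
  fibreClassLefschetz_deg_of_algebraicInvariants hf (q := d - p) (by omega) t₀ (hN p hp) (hN (d - p) (by omega))

end Summit.HodgeConjecture.HodgeConjecture.Ring2.AbelianAll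

end
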